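import Summits.ValiantsHypothesis.ValiantsHypothesis.Theorems.DepthWindowNodeBiasRung

/-!
# Route `DepthWindow` — the top rung of the universal-low-bias ladder for EVERY word (reindexing + greedy order)

Cone-free helper (decomp-valiant lens 4, g13) supporting the crux item `HomImmHardTwoOne`
(stmt-ValiantsHypothesis-30635).  `DepthWindowNodeBias.lean` types the negative of the leaf `TreeBiasGrowth` as the
universal statements `UniversalLowBiasAt C` («at depth `C·log₂log₂ d + c₁` every integer word with `|wᵢ| ≤ h`,
`|Σ w| ≤ h` has a tree all of whose node biases are `≤ B·h`»).  `DepthWindowNodeBiasRung.lean` proved the top rung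
(depth `⌈log₂ d⌉`, node bias `≤ 4h`) for words whose PREFIX sums are bounded by `h` (interval tree).  Here the
order hypothesis is removed, so the top rung holds under exactly the hypotheses of `UniversalLowBiasAt`:

* `LTree.comap`, `nodeBias_comap`, `lowBiasTree_of_comp_equiv` — tree bias data are invariant under reindexing
  the letters (a tree for `w ∘ e` transported along `e : Fin d ≃ Fin d` is a tree for `w` with the same node
  biases): `Treebias` depends on the multiset only;
* `exists_equiv_prefix_bounded` — GREEDY ORDER: if `|wᵢ| ≤ h` for all `i` and `|Σ w| ≤ h`, some ordering of the
  letters has all prefix sums in `[-h, h]` (always append a letter of sign opposite to the running sum if one is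
  left; otherwise the running sums move monotonically to the total);
* `lowBiasTree_clog_of_bounded` — hence EVERY such word has a `LowBiasTree` at depth `⌈log₂ d⌉` with node bias
  `≤ 4h`: the slope-`∞` member `ULB_∞` of the ladder `ULB_∞ ⇒ … ⇒ ULB_C ⇒ … ⇒ ULB₂` is a theorem; `ULB_C` asks the
  same at depth `C·log₂log₂ d + O(1)`.

References: [LimayeSrinivasanTavenas2022] CCC 2022 (LIPIcs 234:32) Def. 15, Prop. 17 (full version ECCC TR22-090).
-/

-- layout Summits/ValiantsHypothesis/ValiantsHypothesis forces the duplicated namespace component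
set_option linter.dupNamespace false

namespace Summit.ValiantsHypothesis.ValiantsHypothesis.Theorems.DepthWindow.TreeBias

open Finset

variable {d : ℕ}

/-! ### Reindexing -/

/-- Transport of a levelled tree along a permutation `e` of the letters: leaf `i` of the new tree sits where leaf
`e⁻¹ i` sat in `T` (labels pushed forward by `e` so that level `0` is still the identity). [folklore] -/
def LTree.comap (T : LTree d) (e : Fin d ≃ Fin d) : LTree d where
  lab t i := e (T.lab t (e.symm i))
  leaf i := by simp [T.leaf]
  refine t i j h := by
    have h' : T.lab t (e.symm i) = T.lab t (e.symm j) := e.injective h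
    simp [T.refine t _ _ h']

/-- Block sums of the transported tree are block sums of the reindexed word. [folklore] -/
theorem blockSum_comap (w : Fin d → ℤ) (T : LTree d) (e : Fin d ≃ Fin d) (t : ℕ) (l : Fin d) :
    blockSum w (T.comap e) t l = blockSum (w ∘ e) T t (e.symm l) := by
  unfold blockSum
  rw [sum_filter, sum_filter, ← Equiv.sum_comp e]
  refine sum_congr rfl fun j _ => ?_
  simp [LTree.comap, Equiv.apply_eq_iff_eq_symm_apply]

/-- Node biases of the transported tree are node biases of the reindexed word. [folklore] -/
theorem nodeBias_comap (w : Fin d → ℤ) (T : LTree d) (e : Fin d ≃ Fin d) (u : ℕ) (i : Fin d) :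
    nodeBias w (T.comap e) u i = nodeBias (w ∘ e) T u (e.symm i) := by
  unfold nodeBias
  have hset : (univ.filter fun j => (T.comap e).lab u j = (T.comap e).lab u i).image ((T.comap e).lab (u - 1)) =
      ((univ.filter fun j => T.lab u j = T.lab u (e.symm i)).image (T.lab (u - 1))).image e := by
    ext l
    simp only [mem_image, mem_filter, mem_univ, true_and, LTree.comap]
    constructor
    · rintro ⟨j, hj, rfl⟩
      exact ⟨T.lab (u - 1) (e.symm j), ⟨e.symm j, e.injective hj, rfl⟩, rfl⟩
    · rintro ⟨l', ⟨j', hj', rfl⟩, rfl⟩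
      exact ⟨e j', by simp [hj'], by simp⟩
  rw [hset, sum_image fun x _ y _ hxy => e.injective hxy]
  refine sum_congr rfl fun l' _ => ?_
  rw [blockSum_comap, Equiv.symm_apply_apply]

/-- **Reindexing invariance of low-bias trees**: a low-bias tree for the reindexed word `w ∘ e` transports to
one for `w` (same depth, same node-bias bound). [folklore] -/
theorem lowBiasTree_of_comp_equiv {w : Fin d → ℤ} (e : Fin d ≃ Fin d) {Δ : ℕ} {β : ℤ}
    (hT : LowBiasTree (w ∘ e) Δ β) : LowBiasTree w Δ β := by
  obtain ⟨T, hroot, hnb⟩ := hT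
  refine ⟨T.comap e, fun i j => ?_, fun u hu huΔ i => ?_⟩
  · show e (T.lab Δ (e.symm i)) = e (T.lab Δ (e.symm j))
    rw [hroot (e.symm i) (e.symm j)]
  · rw [nodeBias_comap]
    exact hnb u hu huΔ (e.symm i)

/-! ### Greedy order: bounded letters with bounded total admit an order with bounded prefix sums -/

/-- One greedy step: with running sum `P ∈ [-h, h]`, remaining letters `s ≠ ∅` (each in `[-h, h]`) and
`P + Σ_s w ∈ [-h, h]`, some remaining letter keeps the running sum in `[-h, h]` (a letter of sign opposite to `P`
if there is one; otherwise all remaining letters share the sign of `P` and any of them moves `P` towards the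
total). [folklore] -/
theorem exists_greedy_step (w : Fin d → ℤ) (h : ℕ) (hw : ∀ i, |w i| ≤ h) {s : Finset (Fin d)}
    (hs : s.Nonempty) {P : ℤ} (hP : |P| ≤ h) (hsum : |P + ∑ i ∈ s, w i| ≤ h) :
    ∃ x ∈ s, |P + w x| ≤ h := by
  rw [abs_le] at hP hsum
  rcases le_or_gt 0 P with hP0 | hP0
  · by_cases hneg : ∃ x ∈ s, w x ≤ 0
    · obtain ⟨x, hx, hwx⟩ := hneg
      have := (abs_le.1 (hw x)).1
      exact ⟨x, hx, abs_le.2 ⟨by linarith, by linarith⟩⟩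
    · push Not at hneg
      obtain ⟨x, hx⟩ := hs
      have hrest : 0 ≤ ∑ i ∈ s.erase x, w i := sum_nonneg fun i hi => (hneg i (mem_of_mem_erase hi)).le
      have hsplit := add_sum_erase s w hx
      have := hneg x hx
      exact ⟨x, hx, abs_le.2 ⟨by linarith, by linarith⟩⟩
  · by_cases hpos : ∃ x ∈ s, 0 ≤ w x
    · obtain ⟨x, hx, hwx⟩ := hpos
      have := (abs_le.1 (hw x)).2
      exact ⟨x, hx, abs_le.2 ⟨by linarith, by linarith⟩⟩
    · push Not at hpos
      obtain ⟨x, hx⟩ := hs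
      have hrest : ∑ i ∈ s.erase x, w i ≤ 0 := sum_nonpos fun i hi => (hpos i (mem_of_mem_erase hi)).le
      have hsplit := add_sum_erase s w hx
      have := hpos x hx
      exact ⟨x, hx, abs_le.2 ⟨by linarith, by linarith⟩⟩

/-- The greedy order on a set `s` of `n` remaining letters: an injective enumeration `f : Fin n → s` all of whose
running sums `P + w (f 0) + ⋯ + w (f (t-1))` stay in `[-h, h]`. [folklore] -/
theorem exists_greedy_order (w : Fin d → ℤ) (h : ℕ) (hw : ∀ i, |w i| ≤ h) :
    ∀ (n : ℕ) (s : Finset (Fin d)) (P : ℤ), s.card = n → |P| ≤ h → |P + ∑ i ∈ s, w i| ≤ h →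
      ∃ f : Fin n → Fin d, Function.Injective f ∧ (∀ k, f k ∈ s) ∧
        ∀ t : ℕ, |P + ∑ k : Fin n, (if (k : ℕ) < t then w (f k) else 0)| ≤ h
  | 0, s, P, _, hP, _ => ⟨Fin.elim0, fun i => i.elim0, fun k => k.elim0, fun t => by simpa using hP⟩
  | n + 1, s, P, hs, hP, hsum => by
    have hne : s.Nonempty := by rw [← card_pos, hs]; exact Nat.succ_pos n
    obtain ⟨x, hx, hPx⟩ := exists_greedy_step w h hw hne hP hsum
    have hs' : (s.erase x).card = n := by rw [card_erase_of_mem hx, hs]; rfl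
    have hsum' : |P + w x + ∑ i ∈ s.erase x, w i| ≤ h := by rwa [add_assoc, add_sum_erase s w hx]
    obtain ⟨f', hf'inj, hf'mem, hf'pre⟩ := exists_greedy_order w h hw n (s.erase x) (P + w x) hs' hPx hsum'
    refine ⟨Fin.cons x f', ?_, ?_, ?_⟩
    · rw [Fin.cons_injective_iff]
      refine ⟨?_, hf'inj⟩
      rintro ⟨k, hk⟩
      exact ne_of_mem_erase (hf'mem k) hk
    · intro k
      refine Fin.cases ?_ (fun k => ?_) k
      · simpa using hx
      · simpa using mem_of_mem_erase (hf'mem k)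
    · intro t
      rw [Fin.sum_univ_succ]
      simp only [Fin.cons_zero, Fin.cons_succ, Fin.val_zero, Fin.val_succ]
      rcases Nat.eq_zero_or_pos t with rfl | ht
      · simpa using hP
      · have key := hf'pre (t - 1)
        have hiff : ∀ k : Fin n, ((k : ℕ) + 1 < t) = ((k : ℕ) < t - 1) :=
          fun k => propext ⟨fun hk => by omega, fun hk => by omega⟩
        simp only [ht, if_true, hiff, ← add_assoc]
        exact key

/-- **Greedy order**: if `|wᵢ| ≤ h` for every `i` and `|Σᵢ wᵢ| ≤ h`, some permutation `e` of the letters has all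
prefix sums of `w ∘ e` in `[-h, h]`. [folklore] -/
theorem exists_equiv_prefix_bounded (w : Fin d → ℤ) (h : ℕ) (hw : ∀ i, |w i| ≤ h)
    (hsum : |∑ i, w i| ≤ h) :
    ∃ e : Fin d ≃ Fin d, ∀ t : ℕ, |∑ j ∈ univ.filter (fun j : Fin d => (j : ℕ) < t), (w ∘ e) j| ≤ h := by
  obtain ⟨f, hfinj, -, hfpre⟩ := exists_greedy_order w h hw d univ 0 (by simp) (by simp) (by simpa using hsum)
  refine ⟨Equiv.ofBijective f (Finite.injective_iff_bijective.1 hfinj), fun t => ?_⟩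
  rw [sum_filter]
  simpa using hfpre t

/-! ### The top rung for every word -/

/-- **`ULB_∞` (top rung of the universal-low-bias ladder, unconditional)**: every integer word with
`|wᵢ| ≤ h` and `|Σ w| ≤ h` has a low-bias tree of depth `⌈log₂ d⌉` with all node biases `≤ 4h` (greedy order,
then the interval tree, then transport back).  `UniversalLowBiasAt C` asks for depth `C·⌊log₂⌊log₂ d⌋⌋ + c₁`
instead. [cite: LimayeSrinivasanTavenas2022, Def. 15] -/
theorem lowBiasTree_clog_of_bounded (w : Fin d → ℤ) (h : ℕ) (hw : ∀ i, |w i| ≤ h) (hsum : |∑ i, w i| ≤ h) :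
    LowBiasTree w (Nat.clog 2 d) ((4 * h : ℕ) : ℤ) := by
  obtain ⟨e, he⟩ := exists_equiv_prefix_bounded w h hw hsum
  exact lowBiasTree_of_comp_equiv e (lowBiasTree_clog (w ∘ e) h he)

/-- Hence no word as in `UniversalLowBiasAt` has tree bias above `⌈log₂ d⌉·4h` at depth `⌈log₂ d⌉` — and, by
padding (`treeBiasGe_anti_depth` of `DepthWindowTreeBiasMono`), at no larger depth either. [folklore] -/
theorem not_treeBiasGe_clog_of_bounded (w : Fin d → ℤ) (h : ℕ) (hw : ∀ i, |w i| ≤ h) (hsum : |∑ i, w i| ≤ h)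
    {τ : ℕ} (hτ : Nat.clog 2 d * (4 * h) < τ) : ¬ TreeBiasGe w (Nat.clog 2 d) τ :=
  not_treeBiasGe_of_lowBiasTree (lowBiasTree_clog_of_bounded w h hw hsum) (by exact_mod_cast hτ)

end Summit.ValiantsHypothesis.ValiantsHypothesis.Theorems.DepthWindow.TreeBias
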